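import Literature.RingTheory.RegularLocalRing.GrothendieckSamuelHypersurfaceProofs
import Literature.AlgebraicGeometry.Resolution.AdicCompletionRegular
import Literature.AlgebraicGeometry.Resolution.FlatSlicingCriterion
import Mathlib.RingTheory.TensorProduct.Quotient
import Mathlib.RingTheory.Regular.LinearMap
import Mathlib.RingTheory.Flat.FaithfullyFlat.Algebra
import Mathlib.RingTheory.Flat.TorsionFree
import Mathlib.RingTheory.Ideal.Over
import HarnessLib

/-!
# Grothendieck's Samuel conjecture for hypersurface rings — reduction to complete regular
local rings (SGA 2 XI 3.7)

Topic `Literature/RingTheory/RegularLocalRing`. Third file on the named fact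
`Grothendieck1968_samuelConjecture_hypersurface` (SGA 2 XI Cor. 3.14 for the hypersurface rings
`R ⧸ (f)`, `R` regular local), after `GrothendieckSamuelHypersurface.lean` (the fact) and
`GrothendieckSamuelHypersurfaceProofs.lean` (the induction of XI 3.14 and XI 3.10, reducing the
fact to the parafactoriality theorem XI 3.13 (ii) for hypersurfaces, hypothesis `hPara`).
Everything here is PROVED; no named facts.

Grothendieck's proof of XI 3.13 (ii) begins (arXiv:math/0511279, p. 72): "Posons
`A = R/(t_1, …, t_{k-1})` donc `B = A/t_k A`. On peut supposer `B` complet d'après XI.3.7"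
— XI 3.7: "Soit `A` un anneau local noethérien; si `Â` est parafactoriel `A` l'est" (faithfully
flat descent, Lemme 3.6). This file proves that reduction for the ideal-theoretic
parafactoriality used in `hPara`:

* `samuelConjecture_hypersurface_parafactorial_of_complete` — if for every COMPLETE regular
  local `S` (`IsAdicComplete 𝔪_S S`) and `0 ≠ g ∈ 𝔪_S` with `dim S ⧸ (g) ≥ 4`, every
  `𝔪`-saturated ideal of `S ⧸ (g)` containing a regular element and principal at each
  non-maximal prime is principal, then `hPara` holds for every regular local `R`: with
  `R̂ = AdicCompletion 𝔪_R R` (complete, regular local of the same dimension — tree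
  `isRegularLocalRing_adicCompletion`, `ringKrullDim_adicCompletion`; flat — Mathlib
  `AdicCompletion.flat_of_isNoetherian`), the map `A = R ⧸ (f) → B = R̂ ⧸ f R̂` is faithfully
  flat and local with `𝔪_A B = 𝔪_B`; a non-zero `J ⊆ A` gives a regular element of `J B`
  (flatness), principality at the non-maximal primes passes to `J B`
  (`J B_𝔔 = (J A_Q) B_𝔔`, `Q = 𝔔 ∩ A` non-maximal), `𝔪`-saturation passes to `J B` (an
  `(A ⧸ J)`-regular element of `𝔪_A`, which exists by `Hom_A(k, A ⧸ J) = 0` — Mathlib's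
  `IsSMulRegular.subsingleton_linearMap_iff` — stays `(B ⧸ J B)`-regular by flatness), so `J B`,
  transported to `R̂ ⧸ (f)`, is principal by the complete case, and principality descends along
  the faithfully flat local map (`isPrincipal_of_isPrincipal_map_of_faithfullyFlat`).
* `Grothendieck1968_samuelConjecture_hypersurface_of_complete` — the named fact from the complete
  case of XI 3.13 (ii) for hypersurfaces alone (hypothesis `hC`).

Besides: transport of the three conditions along ring isomorphisms (`…_map_ringEquiv`), the
base-change lemmas for `R ⧸ I → S ⧸ I S` along a flat local `R → S` with `𝔪_R S = 𝔪_S`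
(`flat_quotient_map_quotient`, `map_maximalIdeal_quotient_map_quotient`,
`isUnit_of_isUnit_map_quotient`, `not_isMaximal_comap_quotient`,
`isPrincipal_map_localization_map_quotient`, `saturated_map_quotient`), and
`exists_isSMulRegular_of_saturated`.

Also (appended): cover data for an ideal principal on the punctured spectrum
(`exists_cover_of_forall_isPrincipal_map`, `mem_of_forall_pow_mul_mem`), first steps toward the
complete case.

Not here: the complete case of XI 3.13 (ii) itself (local Lefschetz theory, SGA 2 X–XI).

## References

* [Grothendieck1968SGA2] A. Grothendieck, SGA 2, Exp. XI, 3.6, Cor. 3.7, Thm. 3.13 (ii) (proof,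
  p. 72), Cor. 3.14 (arXiv:math/0511279).
* [Matsumura1987] H. Matsumura, *Commutative Ring Theory*, Thm. 8.8/8.14 (completion is
  faithfully flat), §19 (proof of Thm. 19.5: `Â` regular), Thm. 15.1 (`dim Â = dim A`).
-/

universe u

namespace Literature.RingTheory.RegularLocalRing

open IsLocalRing nonZeroDivisors TensorProduct

/-! ## Transport of the parafactoriality conditions along ring isomorphisms -/

section Transfer

variable {B B' : Type u} [CommRing B] [CommRing B'] (e : B ≃+* B') (J : Ideal B)

/-- A regular element of `J` gives a regular element of `e(J)`. [folklore] -/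
theorem exists_mem_nonZeroDivisors_map_ringEquiv (h : ∃ c ∈ J, c ∈ B⁰) :
    ∃ c' ∈ J.map (e : B →+* B'), c' ∈ B'⁰ := by
  obtain ⟨c, hcJ, hc⟩ := h
  refine ⟨e c, Ideal.mem_map_of_mem _ hcJ, mem_nonZeroDivisors_iff_right.mpr fun x hx => ?_⟩
  have h1 : e.symm x * c = 0 := by
    apply e.injective
    rw [map_mul, e.apply_symm_apply, map_zero, hx]
  have h2 : e.symm x = 0 := (mul_right_mem_nonZeroDivisors_eq_zero_iff hc).mp h1
  simpa using congrArg e h2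

/-- `𝔪`-saturation of `J` passes to `e(J)`. [folklore] -/
theorem saturated_map_ringEquiv (h : ∀ b : B, (∀ y : B, ¬ IsUnit y → y * b ∈ J) → b ∈ J) :
    ∀ b' : B', (∀ y' : B', ¬ IsUnit y' → y' * b' ∈ J.map (e : B →+* B')) →
      b' ∈ J.map (e : B →+* B') := by
  intro b' hb'
  have hb : e.symm b' ∈ J := by
    refine h _ fun y hy => ?_
    have h1 : e y * b' ∈ J.map (e : B →+* B') :=
      hb' (e y) fun hu => hy (by simpa using hu.map e.symm)
    have h2 := Ideal.mem_map_of_mem (e.symm : B' →+* B) h1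
    rw [Ideal.map_of_equiv] at h2
    simpa using h2
  have := Ideal.mem_map_of_mem (e : B →+* B') hb
  simpa using this

/-- Principality at the non-maximal primes passes to `e(J)`: the localisation of `B'` at `Q'`
is the localisation of `B` at `e⁻¹(Q')`. [folklore] -/
theorem isPrincipal_map_localization_map_ringEquiv
    (h : ∀ (Q : Ideal B) [Q.IsPrime], ¬ Q.IsMaximal →
      (J.map (algebraMap B (Localization.AtPrime Q))).IsPrincipal) :
    ∀ (Q' : Ideal B') [Q'.IsPrime], ¬ Q'.IsMaximal →
      ((J.map (e : B →+* B')).map (algebraMap B' (Localization.AtPrime Q'))).IsPrincipal := by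
  intro Q' _ hQ'
  set Q : Ideal B := Q'.comap (e : B →+* B') with hQ
  have hQmax : ¬ Q.IsMaximal := by
    intro hQm
    rcases Ideal.map_eq_top_or_isMaximal_of_surjective (e : B →+* B') e.surjective hQm with
      h' | h'
    · rw [hQ, Ideal.map_comap_of_surjective (e : B →+* B') e.surjective] at h'
      exact (inferInstance : Q'.IsPrime).ne_top h'
    · rw [hQ, Ideal.map_comap_of_surjective (e : B →+* B') e.surjective] at h'
      exact hQ' h'
  obtain ⟨x, hx⟩ := h Q hQmax
  have hmap : Q.primeCompl.map (e : B ≃+* B').toMonoidHom = Q'.primeCompl := by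
    ext b
    constructor
    · rintro ⟨a, ha, rfl⟩
      exact fun hb => ha (show a ∈ Q from Ideal.mem_comap.mpr hb)
    · intro hb
      refine ⟨e.symm b, fun ha => hb ?_, by simp⟩
      simpa using (Ideal.mem_comap.mp (show e.symm b ∈ Q from ha))
  set ε := IsLocalization.ringEquivOfRingEquiv (Localization.AtPrime Q) (Localization.AtPrime Q')
    e hmap with hε
  have hcomm : (algebraMap B' (Localization.AtPrime Q')).comp (e : B →+* B') =
      (ε : Localization.AtPrime Q →+* Localization.AtPrime Q').comp
        (algebraMap B (Localization.AtPrime Q)) := by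
    ext b
    simp [hε]
  refine ⟨⟨ε x, ?_⟩⟩
  rw [Ideal.map_map, hcomm, ← Ideal.map_map, hx, Ideal.submodule_span_eq, Ideal.map_span,
    Set.image_singleton, Ideal.submodule_span_eq]
  rfl

/-- If `e(J)` is principal then so is `J`. [folklore] -/
theorem isPrincipal_of_map_ringEquiv (h : (J.map (e : B →+* B')).IsPrincipal) :
    J.IsPrincipal := by
  obtain ⟨x, hx⟩ := h
  refine ⟨⟨e.symm x, ?_⟩⟩
  rw [← Ideal.map_of_equiv (I := J) e]
  change Ideal.map _ (Ideal.map _ J) = _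
  rw [show (Ideal.map (e : B →+* B') J : Ideal B') = Ideal.span {x} from hx,
    Ideal.map_span, Set.image_singleton, Ideal.submodule_span_eq]
  rfl

end Transfer

/-! ## Faithfully flat descent of principality -/

/-- **An ideal which becomes principal in a faithfully flat local extension is principal**
(variant of the tree's `exists_eq_span_singleton_of_map_eq_span_singleton` where the
extension need not be a domain but `J B` contains a regular element): if `J B = (x)` with
`B` local and `A → B` faithfully flat, write `x = ∑ βⱼ gⱼ` over generators `gⱼ` of `J` and
`gⱼ = γⱼ x`; as `x` is regular, `∑ βⱼ γⱼ = 1`, some `γⱼ` is a unit, and `J = (gⱼ)` by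
`J B ∩ A = J`. [folklore] -/
theorem isPrincipal_of_isPrincipal_map_of_faithfullyFlat {A B : Type u} [CommRing A]
    [CommRing B] [Algebra A B] [Module.FaithfullyFlat A B] [IsNoetherianRing A] [IsLocalRing B]
    (J : Ideal A) (hreg : ∃ c ∈ J.map (algebraMap A B), c ∈ B⁰)
    (h : (J.map (algebraMap A B)).IsPrincipal) : J.IsPrincipal := by
  classical
  set φ := algebraMap A B with hφ
  obtain ⟨x, hx⟩ := h
  have hx' : J.map φ = Ideal.span {x} := hx
  -- `x` is a regular element
  obtain ⟨c, hc, hcreg⟩ := hreg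
  have hxreg : x ∈ B⁰ := by
    rw [hx'] at hc
    obtain ⟨d, rfl⟩ := Ideal.mem_span_singleton'.mp hc
    refine mem_nonZeroDivisors_iff_right.mpr fun y hy => ?_
    exact (mul_right_mem_nonZeroDivisors_eq_zero_iff hcreg).mp
      (by rw [← mul_assoc, mul_comm y d, mul_assoc, hy, mul_zero])
  -- generators of `J`
  obtain ⟨m, v, hv⟩ := Submodule.fg_iff_exists_fin_generating_family.mp (IsNoetherian.noetherian J)
  have hvJ : ∀ j, v j ∈ J := fun j => hv ▸ Ideal.subset_span ⟨j, rfl⟩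
  -- `x = Σ βⱼ φ(vⱼ)`
  have hxmem : x ∈ Ideal.span (Set.range (φ ∘ v)) := by
    have : Ideal.span (Set.range (φ ∘ v)) = J.map φ := by
      rw [← hv, Ideal.map_span, Set.range_comp]
    rw [this, hx']
    exact Ideal.mem_span_singleton_self x
  obtain ⟨β, hβ⟩ := Ideal.mem_span_range_iff_exists_fun.mp hxmem
  -- `φ(vⱼ) = γⱼ x`
  have hγ : ∀ j, ∃ γ : B, γ * x = φ (v j) := fun j => by
    have : φ (v j) ∈ J.map φ := Ideal.mem_map_of_mem _ (hvJ j)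
    rw [hx'] at this
    exact Ideal.mem_span_singleton'.mp this
  choose γ hγ using hγ
  -- `Σ βⱼ γⱼ = 1` since `x` is regular
  have hsum : ∑ j, β j * γ j = 1 := by
    have h1 : (∑ j, β j * γ j - 1) * x = 0 := by
      rw [sub_mul, one_mul, Finset.sum_mul, sub_eq_zero]
      conv_rhs => rw [← hβ]
      refine Finset.sum_congr rfl fun j _ => ?_
      rw [mul_assoc, hγ j]
      rfl
    exact sub_eq_zero.mp ((mul_right_mem_nonZeroDivisors_eq_zero_iff hxreg).mp h1)
  -- some `γⱼ` is a unit
  obtain ⟨j, hj⟩ : ∃ j, IsUnit (β j * γ j) := by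
    by_contra hall
    push Not at hall
    have : ∑ j, β j * γ j ∈ maximalIdeal B :=
      Ideal.sum_mem _ fun j _ => (mem_maximalIdeal _).mpr (hall j)
    rw [hsum] at this
    exact (maximalIdeal.isMaximal B).ne_top (Ideal.eq_top_of_isUnit_mem _ this isUnit_one)
  have hγu : IsUnit (γ j) := isUnit_of_mul_isUnit_right hj
  refine ⟨⟨v j, ?_⟩⟩
  have hspan : Ideal.span {φ (v j)} = Ideal.span {x} := by
    rw [← hγ j]
    exact Ideal.span_singleton_mul_left_unit hγu x
  refine le_antisymm ?_ ?_
  · intro z hz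
    have h1 : φ z ∈ (Ideal.span {v j}).map φ := by
      rw [Ideal.map_span, Set.image_singleton, hspan, ← hx']
      exact Ideal.mem_map_of_mem _ hz
    have h2 : z ∈ ((Ideal.span {v j}).map φ).comap φ := Ideal.mem_comap.mpr h1
    rw [Ideal.comap_map_eq_self_of_faithfullyFlat] at h2
    simpa [Ideal.submodule_span_eq] using h2
  · rw [Ideal.submodule_span_eq]
    exact (Ideal.span_singleton_le_iff_mem _).mpr (hvJ j)

/-! ## Base change of the parafactoriality conditions along `R ⧸ I → S ⧸ I S`

For a flat local homomorphism of local rings `R → S` with `𝔪_R S = 𝔪_S` (e.g. the completion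
`R → R̂` of a Noetherian local ring) and a proper ideal `I ⊆ R`, the induced map
`A = R ⧸ I → B = S ⧸ I S` is faithfully flat and local with `𝔪_A B = 𝔪_B`; for an ideal
`J ⊆ A` the three conditions (regular element, principal at the non-maximal primes,
`𝔪`-saturated) pass from `J` to `J B`. -/

section BaseChange

variable {R S : Type u} [CommRing R] [CommRing S] [Algebra R S] [IsLocalRing R] [IsLocalRing S]
  (hmS : (maximalIdeal R).map (algebraMap R S) = maximalIdeal S) (I : Ideal R)
  (hI : I ≤ maximalIdeal R)

omit [IsLocalRing R] [IsLocalRing S] in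
/-- `B = S ⧸ I S` is flat over `A = R ⧸ I` when `S` is flat over `R` (`B = A ⊗_R S`).
[folklore] -/
theorem flat_quotient_map_quotient [Module.Flat R S] :
    Module.Flat (R ⧸ I) (S ⧸ I.map (algebraMap R S)) :=
  Module.Flat.of_linearEquiv
    (Algebra.TensorProduct.quotIdealMapEquivQuotTensor S I).toLinearEquiv

include hI in
/-- `I S` is a proper ideal. [folklore] -/
theorem map_ne_top_of_le_maximalIdeal (hmS : (maximalIdeal R).map (algebraMap R S) = maximalIdeal S) :
    I.map (algebraMap R S) ≠ ⊤ := fun h =>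
  (maximalIdeal.isMaximal S).ne_top (top_le_iff.mp (hmS ▸ h ▸ Ideal.map_mono hI))

include hmS hI in
/-- `𝔪_A B = 𝔪_B` for `A = R ⧸ I → B = S ⧸ I S`. [folklore] -/
theorem map_maximalIdeal_quotient_map_quotient :
    haveI := Literature.AlgebraicGeometry.Resolution.isLocalRing_quotient
      (ne_top_of_le_ne_top (maximalIdeal.isMaximal R).ne_top hI)
    haveI := Literature.AlgebraicGeometry.Resolution.isLocalRing_quotient
      (map_ne_top_of_le_maximalIdeal I hI hmS)
    (maximalIdeal (R ⧸ I)).map (algebraMap (R ⧸ I) (S ⧸ I.map (algebraMap R S))) =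
      maximalIdeal (S ⧸ I.map (algebraMap R S)) := by
  haveI : Nontrivial (R ⧸ I) :=
    Ideal.Quotient.nontrivial_iff.mpr (ne_top_of_le_ne_top (maximalIdeal.isMaximal R).ne_top hI)
  haveI : Nontrivial (S ⧸ I.map (algebraMap R S)) :=
    Ideal.Quotient.nontrivial_iff.mpr (map_ne_top_of_le_maximalIdeal I hI hmS)
  rw [Literature.AlgebraicGeometry.Resolution.maximalIdeal_quotient_eq_map I,
    Literature.AlgebraicGeometry.Resolution.maximalIdeal_quotient_eq_map (I.map (algebraMap R S)),
    Ideal.map_map, ← hmS, Ideal.map_map]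
  congr 1

include hmS hI in
/-- `A = R ⧸ I → B = S ⧸ I S` reflects units (it is a local homomorphism). [folklore] -/
theorem isUnit_of_isUnit_map_quotient {a : R ⧸ I}
    (ha : IsUnit (algebraMap (R ⧸ I) (S ⧸ I.map (algebraMap R S)) a)) : IsUnit a := by
  haveI := Literature.AlgebraicGeometry.Resolution.isLocalRing_quotient
    (ne_top_of_le_ne_top (maximalIdeal.isMaximal R).ne_top hI)
  haveI := Literature.AlgebraicGeometry.Resolution.isLocalRing_quotient
    (map_ne_top_of_le_maximalIdeal I hI hmS)
  by_contra hna
  have hmem : algebraMap (R ⧸ I) (S ⧸ I.map (algebraMap R S)) a ∈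
      maximalIdeal (S ⧸ I.map (algebraMap R S)) := by
    rw [← map_maximalIdeal_quotient_map_quotient hmS I hI]
    exact Ideal.mem_map_of_mem _ ((mem_maximalIdeal _).mpr hna)
  exact (mem_maximalIdeal _).mp hmem ha

include hmS hI in
/-- Non-maximal primes of `B = S ⧸ I S` contract to non-maximal primes of `A = R ⧸ I`
(`B ⧸ 𝔪_A B = B ⧸ 𝔪_B` is a field). [folklore] -/
theorem not_isMaximal_comap_quotient (𝔔 : Ideal (S ⧸ I.map (algebraMap R S))) [𝔔.IsPrime]
    (h𝔔 : ¬ 𝔔.IsMaximal) :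
    ¬ (𝔔.comap (algebraMap (R ⧸ I) (S ⧸ I.map (algebraMap R S)))).IsMaximal := by
  haveI := Literature.AlgebraicGeometry.Resolution.isLocalRing_quotient
    (ne_top_of_le_ne_top (maximalIdeal.isMaximal R).ne_top hI)
  haveI := Literature.AlgebraicGeometry.Resolution.isLocalRing_quotient
    (map_ne_top_of_le_maximalIdeal I hI hmS)
  intro hmax
  have heq := IsLocalRing.eq_maximalIdeal hmax
  have hle : maximalIdeal (S ⧸ I.map (algebraMap R S)) ≤ 𝔔 := by
    rw [← map_maximalIdeal_quotient_map_quotient hmS I hI, ← heq]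
    exact Ideal.map_comap_le
  have : 𝔔 = maximalIdeal _ :=
    le_antisymm (IsLocalRing.le_maximalIdeal (Ideal.IsPrime.ne_top inferInstance)) hle
  exact h𝔔 (this ▸ maximalIdeal.isMaximal _)

/-- A non-zero element of an ideal `J` of the domain `A = R ⧸ I` is a regular element of
`J B` when `B` is flat over `A`. [folklore] -/
theorem exists_mem_nonZeroDivisors_map_of_flat {A B : Type u} [CommRing A] [CommRing B]
    [Algebra A B] [Module.Flat A B] [IsDomain A] (J : Ideal A) (hJ : J ≠ ⊥) :
    ∃ c ∈ J.map (algebraMap A B), c ∈ B⁰ := by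
  obtain ⟨j, hjJ, hj0⟩ := Submodule.exists_mem_ne_zero_of_ne_bot hJ
  refine ⟨algebraMap A B j, Ideal.mem_map_of_mem _ hjJ, ?_⟩
  have hreg : IsSMulRegular B j :=
    Module.Flat.isSMulRegular_of_nonZeroDivisors (mem_nonZeroDivisors_of_ne_zero hj0)
  refine mem_nonZeroDivisors_iff_right.mpr fun b hb => hreg ?_
  show j • b = j • (0 : B)
  rw [smul_zero, Algebra.smul_def, mul_comm]
  exact hb

omit [IsLocalRing R] [IsLocalRing S] in
/-- Principality at the non-maximal primes passes from `J ⊆ A` to `J B ⊆ B = S ⧸ I S`: for a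
non-maximal prime `𝔔` of `B` over `Q ⊆ A` (non-maximal), `J B_𝔔 = (J A_Q) B_𝔔`. [folklore] -/
theorem isPrincipal_map_localization_map_quotient
    (J : Ideal (R ⧸ I))
    (h : ∀ (Q : Ideal (R ⧸ I)) [Q.IsPrime], ¬ Q.IsMaximal →
      (J.map (algebraMap (R ⧸ I) (Localization.AtPrime Q))).IsPrincipal)
    (𝔔 : Ideal (S ⧸ I.map (algebraMap R S))) [𝔔.IsPrime]
    (hQ : ¬ (𝔔.comap (algebraMap (R ⧸ I) (S ⧸ I.map (algebraMap R S)))).IsMaximal) :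
    ((J.map (algebraMap (R ⧸ I) (S ⧸ I.map (algebraMap R S)))).map
      (algebraMap _ (Localization.AtPrime 𝔔))).IsPrincipal := by
  set A := R ⧸ I
  set B := S ⧸ I.map (algebraMap R S)
  set φ := algebraMap A B with hφ
  set Q : Ideal A := 𝔔.comap φ with hQdef
  obtain ⟨x, hx⟩ := h Q hQ
  set ψ := Localization.localRingHom Q 𝔔 φ hQdef with hψ
  have hcomm : (algebraMap B (Localization.AtPrime 𝔔)).comp φ =
      ψ.comp (algebraMap A (Localization.AtPrime Q)) := by
    refine RingHom.ext fun a => ?_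
    rw [RingHom.comp_apply, RingHom.comp_apply, hψ, Localization.localRingHom_to_map]
  refine ⟨⟨ψ x, ?_⟩⟩
  rw [Ideal.map_map, hcomm, ← Ideal.map_map,
    show (J.map (algebraMap A (Localization.AtPrime Q)) : Ideal _) = Ideal.span {x} from hx,
    Ideal.map_span, Set.image_singleton, Ideal.submodule_span_eq]

/-- From `𝔪`-saturation to a regular element: if `J ⊆ A` is `𝔪`-saturated (`𝔪 a ⊆ J ⇒ a ∈ J`)
in the Noetherian local ring `A`, some `r ∈ 𝔪` is a non-zero-divisor on `A ⧸ J`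
(`Hom_A(k, A ⧸ J) = 0`, associated primes and prime avoidance — Mathlib's
`IsSMulRegular.subsingleton_linearMap_iff`). [folklore] -/
theorem exists_isSMulRegular_of_saturated {A : Type u} [CommRing A] [IsLocalRing A]
    [IsNoetherianRing A] (J : Ideal A)
    (hsat : ∀ a : A, (∀ x : A, ¬ IsUnit x → x * a ∈ J) → a ∈ J) :
    ∃ r ∈ maximalIdeal A, IsSMulRegular (A ⧸ J) r := by
  have hsub : Subsingleton ((A ⧸ maximalIdeal A) →ₗ[A] (A ⧸ J)) := by
    refine ⟨fun g g' => ?_⟩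
    have key : ∀ g : (A ⧸ maximalIdeal A) →ₗ[A] (A ⧸ J), g (Ideal.Quotient.mk _ 1) = 0 := by
      intro g
      obtain ⟨a₀, ha₀⟩ := Ideal.Quotient.mk_surjective (g (Ideal.Quotient.mk _ 1))
      have hmem : a₀ ∈ J := by
        refine hsat a₀ fun x hx => ?_
        have hx0 : x • (Ideal.Quotient.mk (maximalIdeal A) 1) = 0 := by
          rw [Algebra.smul_def, Ideal.Quotient.algebraMap_eq, ← map_mul, mul_one,
            Ideal.Quotient.eq_zero_iff_mem]
          exact (mem_maximalIdeal _).mpr hx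
        have h1 : x • g (Ideal.Quotient.mk _ 1) = 0 := by rw [← map_smul, hx0, map_zero]
        rw [← ha₀, Algebra.smul_def, Ideal.Quotient.algebraMap_eq, ← map_mul,
          Ideal.Quotient.eq_zero_iff_mem] at h1
        exact h1
      rw [← ha₀]
      exact Ideal.Quotient.eq_zero_iff_mem.mpr hmem
    ext
    change g (Ideal.Quotient.mk _ 1) = g' (Ideal.Quotient.mk _ 1)
    rw [key g, key g']
  obtain ⟨r, hr, hreg⟩ := IsSMulRegular.subsingleton_linearMap_iff.mp hsub
  refine ⟨r, ?_, hreg⟩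
  have h1 := Module.mem_annihilator.mp hr (Ideal.Quotient.mk _ 1)
  rw [Algebra.smul_def, Ideal.Quotient.algebraMap_eq, ← map_mul, mul_one,
    Ideal.Quotient.eq_zero_iff_mem] at h1
  exact h1

include hmS hI in
/-- `𝔪`-saturation passes from `J ⊆ A` to `J B ⊆ B = S ⧸ I S` along the flat local map
`A → B` (`A` Noetherian): an `(A ⧸ J)`-regular `r ∈ 𝔪_A` stays `(B ⧸ J B)`-regular
(`B ⧸ J B = B ⊗_A (A ⧸ J)`, flatness), and it is a non-unit of `B`. [folklore] -/
theorem saturated_map_quotient [Module.Flat R S] [IsNoetherianRing R] (J : Ideal (R ⧸ I))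
    (hsat : ∀ a : R ⧸ I, (∀ x : R ⧸ I, ¬ IsUnit x → x * a ∈ J) → a ∈ J) :
    ∀ b : S ⧸ I.map (algebraMap R S),
      (∀ y : S ⧸ I.map (algebraMap R S), ¬ IsUnit y →
        y * b ∈ J.map (algebraMap (R ⧸ I) (S ⧸ I.map (algebraMap R S)))) →
      b ∈ J.map (algebraMap (R ⧸ I) (S ⧸ I.map (algebraMap R S))) := by
  set A := R ⧸ I
  set B := S ⧸ I.map (algebraMap R S)
  set φ := algebraMap A B with hφ
  haveI : IsLocalRing A := Literature.AlgebraicGeometry.Resolution.isLocalRing_quotient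
    (ne_top_of_le_ne_top (maximalIdeal.isMaximal R).ne_top hI)
  haveI : Module.Flat A B := flat_quotient_map_quotient I
  obtain ⟨r, hrm, hreg⟩ := exists_isSMulRegular_of_saturated J hsat
  -- `φ r` is `(B ⧸ J B)`-regular
  have h1 : IsSMulRegular (B ⊗[A] (A ⧸ J)) r := IsSMulRegular.lTensor B hreg
  have h2 : IsSMulRegular (B ⊗[A] (A ⧸ J)) (φ r) := by
    refine (isSMulRegular_iff_right_eq_zero_of_smul (M := B ⊗[A] (A ⧸ J)) (r := φ r)).mpr
      fun z hz => h1.right_eq_zero_of_smul ?_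
    rwa [algebraMap_smul] at hz
  have h3 : IsSMulRegular (B ⧸ J.map φ) (φ r) :=
    (Literature.AlgebraicGeometry.Resolution.Matsumura1987.isSMulRegular_baseChange_quotient_iff J).mp
      h2
  -- `φ r` is a non-unit
  have hru : ¬ IsUnit (φ r) := fun hu =>
    (mem_maximalIdeal _).mp hrm (isUnit_of_isUnit_map_quotient hmS I hI hu)
  intro b hb
  have h4 : φ r * b ∈ J.map φ := hb (φ r) hru
  have h6 : Ideal.Quotient.mk (J.map φ) b = 0 := by
    refine h3.right_eq_zero_of_smul ?_
    change Ideal.Quotient.mk (J.map φ) (φ r * b) = 0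
    exact Ideal.Quotient.eq_zero_iff_mem.mpr h4
  exact Ideal.Quotient.eq_zero_iff_mem.mp h6

end BaseChange

/-! ## Reduction of the kernel to complete regular local rings (SGA 2 XI 3.7) -/

/-- **"On peut supposer `B` complet" (SGA 2 XI 3.7 / proof of 3.13 (ii)) for the ideal-theoretic
parafactoriality of hypersurface rings.** Suppose that for every COMPLETE regular local ring `S`
and `0 ≠ g ∈ 𝔪_S` with `dim S ⧸ (g) ≥ 4`, every `𝔪`-saturated ideal of `S ⧸ (g)` containing a
regular element and principal at each non-maximal prime is principal. Then for every regular
local ring `R`, `0 ≠ f ∈ 𝔪_R` with `dim R ⧸ (f) ≥ 4` and `R ⧸ (f)` a domain, every non-zero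
`𝔪`-saturated ideal `J` of `A = R ⧸ (f)` principal at each non-maximal prime is principal
(the hypothesis `hPara` of `Grothendieck1968_samuelConjecture_hypersurface_of_parafactorial`).
Proof: `R̂` is a complete regular local ring of the same dimension (Matsumura 19.5, 15.1; tree
`isRegularLocalRing_adicCompletion`), `A → B = R̂ ⧸ (f) R̂` is faithfully flat and local with
`𝔪_A B = 𝔪_B`, the three conditions pass to `J B` (`exists_mem_nonZeroDivisors_map_of_flat`,
`isPrincipal_map_localization_map_quotient`, `saturated_map_quotient`), so `J B` is principal,
and principality descends (`isPrincipal_of_isPrincipal_map_of_faithfullyFlat`).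
[cite: Grothendieck1968SGA2, Exp. XI Cor. 3.7 and proof of Thm. 3.13 (ii)] -/
theorem samuelConjecture_hypersurface_parafactorial_of_complete
    (hC : ∀ (S : Type u) [CommRing S] [IsRegularLocalRing S] [IsAdicComplete (maximalIdeal S) S]
      (g : S), g ∈ maximalIdeal S → g ≠ 0 → (4 : WithBot ℕ∞) ≤ ringKrullDim (S ⧸ Ideal.span {g}) →
      ∀ (J : Ideal (S ⧸ Ideal.span {g})), (∃ c ∈ J, c ∈ (S ⧸ Ideal.span {g})⁰) →
        (∀ (Q : Ideal (S ⧸ Ideal.span {g})) [Q.IsPrime], ¬ Q.IsMaximal →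
          (J.map (algebraMap (S ⧸ Ideal.span {g}) (Localization.AtPrime Q))).IsPrincipal) →
        (∀ a : S ⧸ Ideal.span {g}, (∀ x : S ⧸ Ideal.span {g}, ¬ IsUnit x → x * a ∈ J) → a ∈ J) →
        J.IsPrincipal)
    (R : Type u) [CommRing R] [IsRegularLocalRing R] (f : R) (hf : f ∈ maximalIdeal R)
    (hf0 : f ≠ 0) (h4 : (4 : WithBot ℕ∞) ≤ ringKrullDim (R ⧸ Ideal.span {f}))
    (hdom : IsDomain (R ⧸ Ideal.span {f})) (J : Ideal (R ⧸ Ideal.span {f})) (hJ : J ≠ ⊥)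
    (hloc : ∀ (Q : Ideal (R ⧸ Ideal.span {f})) [Q.IsPrime], ¬ Q.IsMaximal →
      (J.map (algebraMap (R ⧸ Ideal.span {f}) (Localization.AtPrime Q))).IsPrincipal)
    (hsat : ∀ a : R ⧸ Ideal.span {f}, (∀ x : R ⧸ Ideal.span {f}, ¬ IsUnit x → x * a ∈ J) → a ∈ J) :
    J.IsPrincipal := by
  haveI := hdom
  have hI : Ideal.span {f} ≤ maximalIdeal R := (Ideal.span_singleton_le_iff_mem _).mpr hf
  haveI : IsDomain R := Literature.AlgebraicGeometry.Resolution.isDomain_of_isRegularLocalRing R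
  -- the completion `R̂`: a complete regular local ring of the same dimension, flat over `R`
  set Rh := AdicCompletion (maximalIdeal R) R with hRh
  haveI : IsRegularLocalRing Rh :=
    Literature.AlgebraicGeometry.Resolution.isRegularLocalRing_adicCompletion R
  haveI : IsDomain Rh := Literature.AlgebraicGeometry.Resolution.isDomain_of_isRegularLocalRing Rh
  haveI : Module.FaithfullyFlat R Rh := Module.FaithfullyFlat.of_flat_of_isLocalHom
  have hmS : (maximalIdeal R).map (algebraMap R Rh) = maximalIdeal Rh :=
    AdicCompletion.maximalIdeal_eq_map.symm
  set fh : Rh := algebraMap R Rh f with hfh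
  have hfhm : fh ∈ maximalIdeal Rh := hmS ▸ Ideal.mem_map_of_mem _ hf
  have hfh0 : fh ≠ 0 := fun h =>
    hf0 (FaithfulSMul.algebraMap_injective R Rh (by rw [map_zero]; exact h))
  -- `B = R̂ ⧸ f R̂`, flat and local over `A = R ⧸ (f)`
  set B := Rh ⧸ (Ideal.span {f}).map (algebraMap R Rh) with hB
  have hIne : Ideal.span {f} ≠ ⊤ := ne_top_of_le_ne_top (maximalIdeal.isMaximal R).ne_top hI
  have hIBne : (Ideal.span {f}).map (algebraMap R Rh) ≠ ⊤ :=
    map_ne_top_of_le_maximalIdeal (Ideal.span {f}) hI hmS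
  haveI : IsLocalRing (R ⧸ Ideal.span {f}) :=
    Literature.AlgebraicGeometry.Resolution.isLocalRing_quotient hIne
  haveI : IsLocalRing B := Literature.AlgebraicGeometry.Resolution.isLocalRing_quotient hIBne
  haveI : Module.Flat (R ⧸ Ideal.span {f}) B := flat_quotient_map_quotient (Ideal.span {f})
  haveI : IsLocalHom (algebraMap (R ⧸ Ideal.span {f}) B) :=
    ⟨fun a ha => isUnit_of_isUnit_map_quotient hmS (Ideal.span {f}) hI ha⟩
  haveI : Module.FaithfullyFlat (R ⧸ Ideal.span {f}) B :=
    Module.FaithfullyFlat.of_flat_of_isLocalHom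
  -- the three conditions for `J B`
  set JB : Ideal B := J.map (algebraMap (R ⧸ Ideal.span {f}) B) with hJB
  have hregB : ∃ c ∈ JB, c ∈ B⁰ := exists_mem_nonZeroDivisors_map_of_flat J hJ
  have hlocB : ∀ (𝔔 : Ideal B) [𝔔.IsPrime], ¬ 𝔔.IsMaximal →
      (JB.map (algebraMap B (Localization.AtPrime 𝔔))).IsPrincipal := fun 𝔔 _ h𝔔 =>
    isPrincipal_map_localization_map_quotient (Ideal.span {f}) J hloc 𝔔
      (not_isMaximal_comap_quotient hmS (Ideal.span {f}) hI 𝔔 h𝔔)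
  have hsatB : ∀ b : B, (∀ y : B, ¬ IsUnit y → y * b ∈ JB) → b ∈ JB :=
    saturated_map_quotient hmS (Ideal.span {f}) hI J hsat
  -- `B ≃ R̂ ⧸ (f̂)`
  have hspan : (Ideal.span {f}).map (algebraMap R Rh) = Ideal.span {fh} := by
    rw [Ideal.map_span, Set.image_singleton]
  set e : B ≃+* Rh ⧸ Ideal.span {fh} := Ideal.quotEquivOfEq hspan with he
  -- `dim R̂ ⧸ (f̂) = dim R ⧸ (f) ≥ 4`
  have h4' : (4 : WithBot ℕ∞) ≤ ringKrullDim (Rh ⧸ Ideal.span {fh}) := by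
    have hne' : Ideal.span {fh} ≠ ⊤ := hspan ▸ hIBne
    haveI : IsLocalRing (Rh ⧸ Ideal.span {fh}) :=
      Literature.AlgebraicGeometry.Resolution.isLocalRing_quotient hne'
    obtain ⟨a, ha⟩ := Literature.AlgebraicGeometry.Resolution.exists_nat_cast_eq_ringKrullDim
      (R := Rh ⧸ Ideal.span {fh})
    obtain ⟨b, hb⟩ := Literature.AlgebraicGeometry.Resolution.exists_nat_cast_eq_ringKrullDim
      (R := R ⧸ Ideal.span {f})
    have h1 := ringKrullDim_quotient_span_singleton_succ_eq_ringKrullDim_of_mem_nonZeroDivisors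
      (mem_nonZeroDivisors_of_ne_zero hfh0) hfhm
    have h2 := ringKrullDim_quotient_span_singleton_succ_eq_ringKrullDim_of_mem_nonZeroDivisors
      (mem_nonZeroDivisors_of_ne_zero hf0) hf
    rw [Literature.AlgebraicGeometry.Resolution.ringKrullDim_adicCompletion R, ← h2, ha, hb] at h1
    rw [hb] at h4
    rw [ha]
    have hab : ((a + 1 : ℕ) : WithBot ℕ∞) = ((b + 1 : ℕ) : WithBot ℕ∞) := by
      push_cast; exact h1
    have hab' : a = b := Nat.succ_injective (by exact_mod_cast hab)
    rwa [hab']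
  -- apply the complete case to `e(J B) ⊆ R̂ ⧸ (f̂)`, then descend
  have hP : ((JB.map (e : B →+* Rh ⧸ Ideal.span {fh}))).IsPrincipal :=
    hC Rh fh hfhm hfh0 h4' _ (exists_mem_nonZeroDivisors_map_ringEquiv e JB hregB)
      (isPrincipal_map_localization_map_ringEquiv e JB hlocB)
      (saturated_map_ringEquiv e JB hsatB)
  have hPB : JB.IsPrincipal := isPrincipal_of_map_ringEquiv e JB hP
  exact isPrincipal_of_isPrincipal_map_of_faithfullyFlat J hregB hPB

/-- **SGA 2 XI Cor. 3.14 for hypersurfaces, reduced to the parafactoriality theorem XI 3.13 (ii)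
for hypersurfaces in COMPLETE regular local rings** (ideal-theoretic form, hypothesis `hC`):
composition of `samuelConjecture_hypersurface_parafactorial_of_complete` (XI 3.7) with
`Grothendieck1968_samuelConjecture_hypersurface_of_parafactorial` (XI 3.10 and the induction of
XI 3.14). [cite: Grothendieck1968SGA2, Exp. XI Cor. 3.7, Cor. 3.10, Thm. 3.13 (ii), Cor. 3.14] -/
theorem Grothendieck1968_samuelConjecture_hypersurface_of_complete
    (hC : ∀ (S : Type u) [CommRing S] [IsRegularLocalRing S] [IsAdicComplete (maximalIdeal S) S]
      (g : S), g ∈ maximalIdeal S → g ≠ 0 → (4 : WithBot ℕ∞) ≤ ringKrullDim (S ⧸ Ideal.span {g}) →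
      ∀ (J : Ideal (S ⧸ Ideal.span {g})), (∃ c ∈ J, c ∈ (S ⧸ Ideal.span {g})⁰) →
        (∀ (Q : Ideal (S ⧸ Ideal.span {g})) [Q.IsPrime], ¬ Q.IsMaximal →
          (J.map (algebraMap (S ⧸ Ideal.span {g}) (Localization.AtPrime Q))).IsPrincipal) →
        (∀ a : S ⧸ Ideal.span {g}, (∀ x : S ⧸ Ideal.span {g}, ¬ IsUnit x → x * a ∈ J) → a ∈ J) →
        J.IsPrincipal) :
    Grothendieck1968_samuelConjecture_hypersurface.{u} :=
  Grothendieck1968_samuelConjecture_hypersurface_of_parafactorial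
    fun R _ _ f hf hf0 h4 hdom J hJ hloc hsat =>
      samuelConjecture_hypersurface_parafactorial_of_complete hC R f hf hf0 h4 hdom J hJ hloc hsat

/-! ## Toward XI 3.13 (ii): cover data for an ideal principal on the punctured spectrum

For the kernel `hC`: an ideal `J` of a Noetherian local ring `B` that is principal at every
non-maximal prime is principal on a finite cover `D(y_1), …, D(y_s)` of the punctured spectrum by
basic opens (`y_i J ⊆ (a_i)`, `√(y) = 𝔪`), and an `𝔪`-saturated `J` is recovered from the
`J B_{y_i}` (`mem_of_forall_pow_mul_mem`). -/

/-- Clearing denominators: if `J B_Q` is principal then `t J ⊆ (a)` for some `a ∈ J`, `t ∉ Q`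
(any commutative ring). [folklore] -/
theorem exists_mem_forall_mul_mem_span_of_isPrincipal_map' {B : Type u} [CommRing B]
    (J : Ideal B) (hfg : J.FG) (Q : Ideal B) [Q.IsPrime]
    (h : (J.map (algebraMap B (Localization.AtPrime Q))).IsPrincipal) :
    ∃ a ∈ J, ∃ t ∉ Q, ∀ b ∈ J, t * b ∈ Ideal.span {a} := by
  classical
  set BQ := Localization.AtPrime Q
  obtain ⟨g, hg⟩ := h
  have hgmem : g ∈ J.map (algebraMap B BQ) := by rw [hg]; exact Ideal.mem_span_singleton_self g
  obtain ⟨⟨⟨a, haJ⟩, s⟩, hs⟩ := (IsLocalization.mem_map_algebraMap_iff Q.primeCompl BQ).mp hgmem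
  simp only at hs
  have hmap : J.map (algebraMap B BQ) = Ideal.span {algebraMap B BQ a} := by
    rw [hg, ← hs]
    exact (Ideal.span_singleton_mul_right_unit (IsLocalization.map_units BQ s) g).symm
  have key : ∀ b ∈ J, ∃ u ∉ Q, u * b ∈ Ideal.span {a} := by
    intro b hb
    have hb' : algebraMap B BQ b ∈ Ideal.span {algebraMap B BQ a} := by
      rw [← hmap]; exact Ideal.mem_map_of_mem _ hb
    obtain ⟨c, hc⟩ := Ideal.mem_span_singleton'.mp hb'
    obtain ⟨⟨b', u⟩, hu⟩ := IsLocalization.surj Q.primeCompl c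
    simp only at hu
    have heq : algebraMap B BQ (u * b) = algebraMap B BQ (b' * a) := by
      rw [map_mul, map_mul, ← hu, ← hc]; ring
    obtain ⟨v, hv⟩ := (IsLocalization.eq_iff_exists Q.primeCompl BQ).mp heq
    refine ⟨v * u, ?_, Ideal.mem_span_singleton'.mpr ⟨v * b', ?_⟩⟩
    · exact (Q.primeCompl.mul_mem v.2 u.2 : (v : B) * u ∈ Q.primeCompl)
    · -- hv : ↑v * (↑u * b) = ↑v * (b' * a)
      calc (v : B) * b' * a = (v : B) * (b' * a) := by ring
        _ = (v : B) * (u * b) := hv.symm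
        _ = (v : B) * u * b := by ring
  choose! u hu using key
  obtain ⟨S, hS⟩ := hfg
  have hSJ : ∀ b ∈ S, b ∈ J := fun b hb => hS ▸ Ideal.subset_span hb
  refine ⟨a, haJ, ∏ b ∈ S, u b, ?_, ?_⟩
  · have : (∏ b ∈ S, u b) ∈ Q.primeCompl :=
      prod_mem (S := Q.primeCompl) fun b hb => (hu b (hSJ b hb)).1
    exact this
  · intro b hb
    rw [← hS] at hb
    refine Submodule.span_induction (p := fun b _ => (∏ b ∈ S, u b) * b ∈ Ideal.span {a})
      ?_ ?_ ?_ ?_ hb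
    · intro z hz
      rw [← Finset.mul_prod_erase S u hz, mul_comm (u z), mul_assoc]
      exact Ideal.mul_mem_left _ _ (hu z (hSJ z hz)).2
    · simp
    · intro z w _ _ hz hw
      rw [mul_add]; exact Ideal.add_mem _ hz hw
    · intro r z _ hz
      rw [smul_eq_mul, mul_left_comm]
      exact Ideal.mul_mem_left _ _ hz

/-- **Cover data for an ideal that is principal on the punctured spectrum.** If `B` is a
Noetherian local ring and the ideal `J` is principal at every non-maximal prime, there are
finitely many `y_1, …, y_s ∈ 𝔪` with `√(y_1, …, y_s) = 𝔪` and `a_i ∈ J` with `y_i J ⊆ (a_i)`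
(so `J B_{y_i} = a_i B_{y_i}`, and the `D(y_i)` cover the punctured spectrum). [folklore] -/
theorem exists_cover_of_forall_isPrincipal_map {B : Type u} [CommRing B] [IsLocalRing B]
    [IsNoetherianRing B] (J : Ideal B)
    (h : ∀ (Q : Ideal B) [Q.IsPrime], ¬ Q.IsMaximal →
      (J.map (algebraMap B (Localization.AtPrime Q))).IsPrincipal) :
    ∃ (s : ℕ) (y : Fin s → B) (a : Fin s → B), (∀ i, y i ∈ maximalIdeal B) ∧ (∀ i, a i ∈ J) ∧
      (∀ i, ∀ b ∈ J, y i * b ∈ Ideal.span {a i}) ∧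
      (Ideal.span (Set.range y)).radical = maximalIdeal B := by
  classical
  -- the set of admissible `t`
  set T : Set B := {t | t ∈ maximalIdeal B ∧ ∃ a ∈ J, ∀ b ∈ J, t * b ∈ Ideal.span {a}} with hT
  set I : Ideal B := Ideal.span T with hI
  have hIle : I ≤ maximalIdeal B := Ideal.span_le.mpr fun t ht => ht.1
  -- `I ⊄ Q` for every non-maximal prime `Q`
  have hIQ : ∀ (Q : Ideal B) [Q.IsPrime], ¬ Q.IsMaximal → ¬ I ≤ Q := by
    intro Q _ hQ hIQ
    obtain ⟨a, haJ, t, htQ, hta⟩ :=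
      exists_mem_forall_mul_mem_span_of_isPrincipal_map' J (IsNoetherian.noetherian J) Q (h Q hQ)
    -- some `x ∈ 𝔪 ∖ Q`
    have hQm : Q < maximalIdeal B :=
      lt_of_le_of_ne (IsLocalRing.le_maximalIdeal (Ideal.IsPrime.ne_top inferInstance))
        fun e => hQ (e ▸ maximalIdeal.isMaximal B)
    obtain ⟨x, hxm, hxQ⟩ := SetLike.exists_of_lt hQm
    have hxt : x * t ∈ T := ⟨Ideal.mul_mem_right _ _ hxm, a, haJ, fun b hb => by
      rw [mul_assoc]; exact Ideal.mul_mem_left _ _ (hta b hb)⟩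
    have : x * t ∈ Q := hIQ (Ideal.subset_span hxt)
    exact ((inferInstance : Q.IsPrime).mem_or_mem this).elim hxQ htQ
  -- hence `√I = 𝔪`
  have hrad : I.radical = maximalIdeal B := by
    refine le_antisymm ?_ ?_
    · exact (Ideal.radical_mono hIle).trans_eq
        (Ideal.IsPrime.radical (maximalIdeal.isMaximal B).isPrime)
    · rw [Ideal.radical_eq_sInf]
      refine le_sInf fun Q hQ => ?_
      obtain ⟨hIQ', hQp⟩ := hQ
      haveI : Q.IsPrime := hQp
      by_contra hmQ
      have hQmax : ¬ Q.IsMaximal := fun hm => hmQ (le_of_eq (IsLocalRing.eq_maximalIdeal hm).symm)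
      exact hIQ Q hQmax hIQ'
  -- finitely many generators of `I` taken from `T`
  obtain ⟨F, hFT, hFI⟩ :=
    (Submodule.fg_span_iff_fg_span_finset_subset T).mp (IsNoetherian.noetherian I)
  -- enumerate `F`
  let e := F.equivFin
  let y : Fin F.card → B := fun i => (e.symm i : B)
  have hyT : ∀ i, y i ∈ T := fun i => hFT (e.symm i).2
  choose a ha using fun i => (hyT i).2
  refine ⟨F.card, y, a, fun i => (hyT i).1, fun i => (ha i).1, fun i => (ha i).2, ?_⟩
  have hrange : Set.range y = (F : Set B) := by
    ext b
    constructor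
    · rintro ⟨i, rfl⟩
      exact (e.symm i).2
    · intro hb
      exact ⟨e ⟨b, hb⟩, by simp [y]⟩
  rw [hrange]
  change (Ideal.span (F : Set B)).radical = _
  have hFI' : Ideal.span (F : Set B) = I := hFI.symm
  rw [hFI']
  exact hrad

/-- **Saturated ideals are determined on the punctured spectrum**: if `J` is `𝔪`-saturated
(`𝔪 b ⊆ J ⇒ b ∈ J`) and `√(y_1, …, y_s) = 𝔪`, then `b ∈ J` as soon as `y_i^{n_i} b ∈ J` for
every `i`. [folklore] -/
theorem mem_of_forall_pow_mul_mem {B : Type u} [CommRing B] [IsLocalRing B] [IsNoetherianRing B]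
    (J : Ideal B) (hsat : ∀ b : B, (∀ x : B, ¬ IsUnit x → x * b ∈ J) → b ∈ J)
    {s : ℕ} (y : Fin s → B) (hrad : (Ideal.span (Set.range y)).radical = maximalIdeal B)
    (b : B) (hb : ∀ i, ∃ n : ℕ, y i ^ n * b ∈ J) : b ∈ J := by
  -- the ideal of multipliers of `b` into `J`
  set Kb : Ideal B := Submodule.comap (LinearMap.mulRight B b) J with hKb
  have hmemKb : ∀ r : B, r ∈ Kb ↔ r * b ∈ J := fun r => Iff.rfl
  have hle : maximalIdeal B ≤ Kb.radical := by
    rw [← hrad]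
    refine Ideal.radical_le_radical_iff.mpr (Ideal.span_le.mpr ?_)
    rintro _ ⟨i, rfl⟩
    obtain ⟨n, hn⟩ := hb i
    exact ⟨n, (hmemKb _).mpr hn⟩
  obtain ⟨k, hk⟩ := Ideal.exists_pow_le_of_le_radical_of_fg hle (IsNoetherian.noetherian _)
  -- peel off `𝔪^k` by saturation
  have key : ∀ k : ℕ, (∀ z ∈ maximalIdeal B ^ k, z * b ∈ J) → b ∈ J := by
    intro k
    induction k with
    | zero =>
      intro hz
      simpa using hz 1 (by simp)
    | succ k ih =>
      intro hz
      refine ih fun w hw => hsat (w * b) fun x hx => ?_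
      rw [← mul_assoc]
      exact hz (x * w) (by
        rw [pow_succ']
        exact Ideal.mul_mem_mul ((IsLocalRing.mem_maximalIdeal x).mpr hx) hw)
  exact key k fun z hz => (hmemKb z).mp (hk hz)

end Literature.RingTheory.RegularLocalRing
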